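import Summits.QuantumFields.BalabanUV.T4Continuum.Support.B13HistMeasurable
import Summits.QuantumFields.BalabanUV.T4Continuum.Support.B13CarriersFootprint
import Summits.QuantumFields.BalabanUV.T4Continuum.Support.SubstrateTwoRunsDriven

/-!
# SUBSTRATE — THE POTENTIAL FRAME OF RECORD on the carriers of record: arguments = bond configurations with values in a measurable
# coordinate model `A` on run A's finest lattice, bond variables = the coordinates of the bond letters on the domain's bond set, volume =
# cube count, the [II] §1 constants as letters — the `MeasPotFrame R.carriers` NE5's term cores and measurable history space are typed over
# (new MAP item S-FRAME; typed: `SubstrateSketch.v0.3` §FR)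

Cell `pub-balaban`, SUBSTRATE cell, seat `b2b-balaban-substrate-p1` (typer NEXT (2)).  Summits-side under the LEAN PLACEMENT RULE.  HONEST
FRAMING: rung (B)+1 of the FINITE-VOLUME T⁴ programme — NOT infinite volume, NOT a mass gap, NOT Clay; spine PROVED 0∕9.  DATA ONLY: the tree
had no `MeasPotFrame` of record (only `B13HistWitness.toyFrame`, `B13TermDataWitness.toyFrame`); this file fixes ONE on the carriers of record
`B13Carriers.TwoRuns.carriers` (p207668); the coordinate model `A` (e.g. `Matrix (Fin N) (Fin N) ℂ` for the complexified group) and its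
coordinates, the bond-set map and the constants are the instancer's letters; locality of the potentials is a DISPLAYED property of the data put
into the frame, not a typing restriction.  Nothing printed is asserted.
HONEST DEPENDENCY (cell line, verbatim): continuum YM on T⁴ ⇐ BetaPertH ∧ nine spine estimates (0/9 proved); BetaPertH ⇐ (D1) ∧ (D4) ∧
CAP+tail; G-an2-4 gates asym, D1 and NE2/3/4.

WHAT.  `frameOfRecord R A nA coord hcoord bonds consts pos : MeasPotFrame R.carriers` (sketch §FR verbatim): `Arg Y := PBond (R.F.P R.K) 0 → A`
(configurations on the WHOLE fine torus of run A, at every domain), `Bond Y := ↥(bonds Y) × Fin nA` (bond of the domain × coordinate index),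
`Bv Y φ (b, a) := coord (φ b) a`, `vol Y := |Y|` (cube count `Y.2.1.card`), constants of record; measurability of the bond variables from the
measurability of the coordinates.  The BOND SET OF RECORD: `B13CarriersFootprint.bondsAt X 0` (the fine bonds sourced in the cubes of `X`,
p208379) — `frameOfRecordStd`.  Unfolding lemmas (`rfl`).
v1.1 (APPEND-ONLY; MAP v0.5 §O1 O-3′ FRAME rider = F-ne9leaf04g12-1 repair (i), typer sketch v0.5 §FRL verbatim; frame OF RECORD per NE5-p1 g34
R45): §2 the LEVEL-POLYMORPHIC constructor `frameOfRecordLvl R A nA coord hcoord lvl bonds consts pos` (`Arg X := PBond (R.F.P R.K) (lvl X) → A`,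
`Bond X := ↥(bonds X) × Fin nA`) and the PRINT placement **`frameAtScale`** (`lvl X := X.1`, `bonds X := bondsAt X X.1` — the fluctuation field of
`Y ∈ 𝐃_k` lives on run A's level `k = Y.1`, [I] p. 269 §3 ¶1, [II] (1.40)–(1.43) pp. 10–11, KIND only), `frameAtScale_Bond` (rfl), [II] (1.43)'s
count `card_Bond_frameAtScale : |Bond X| = |bondsAt X X.1| · nA`, `frameOfDrivenScale`; `frameOfRecord ∕ frameOfRecordStd ∕ frameOfDriven` STAY
as the level-0 variant (not of record for domains of scale ≥ 1).
Imports `B13HistMeasurable` (NE5 O1-c), `B13CarriersFootprint`, `SubstrateTwoRunsDriven`; nothing existing is modified.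
-/

noncomputable section

namespace Summit.QuantumFields.BalabanUV.T4Continuum.SubstrateFrameOfRecord

open Literature.MathematicalPhysics.QuantumFieldTheory.Balaban1983to89
open Summit.QuantumFields.BalabanUV.T4Continuum.B13Carriers (TwoRuns)
open Summit.QuantumFields.BalabanUV.T4Continuum.B13HistDatum (PosUnits)
open Summit.QuantumFields.BalabanUV.T4Continuum.B13HistMeasurable (MeasPotFrame)
open Summit.QuantumFields.BalabanUV.T4Continuum.B13CarriersFootprint (bondsAt)
open Summit.QuantumFields.BalabanUV.T4Continuum.SubstrateTwoRunsDriven (DrivenRuns)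

variable {𝔾 : Type} [GaugeGroup 𝔾] (R : TwoRuns 𝔾)

/-- [folklore] DATA **`frameOfRecord`** (sketch v0.3 §FR verbatim): `Arg Y := PBond (R.F.P R.K) 0 → A`, `Bond Y := ↥(bonds Y) × Fin nA`,
`Bv Y φ (b, a) := coord (φ b) a`, `vol Y := |Y|` in cubes, the [II] §1 constants of record; measurable bond variables from measurable coordinates.
The LEVEL-0 variant (`= frameOfRecordLvl … (lvl ≡ 0)`): not of record for domains of scale ≥ 1 — of record is `frameAtScale` (§2, NE5-p1 R45). -/
def frameOfRecord (A : Type) [MeasurableSpace A] (nA : ℕ) (coord : A → Fin nA → ℂ) (hcoord : ∀ a, Measurable fun x => coord x a)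
    (bonds : R.carriers.Dom → Finset (PBond (R.F.P R.K) 0)) (consts : B13.Consts) (pos : PosUnits consts) :
    MeasPotFrame R.carriers where
  Arg := fun _ => PBond (R.F.P R.K) 0 → A
  Bond := fun Y => ↥(bonds Y) × Fin nA
  finBond := fun _ => inferInstance
  Bv := fun _ φ b => coord (φ b.1.1) b.2
  vol := fun Y => Y.2.1.card
  consts := consts
  pos := pos
  meas := fun _ => inferInstance
  measurable_Bv := fun _ b => (hcoord b.2).comp (measurable_pi_apply _)

section Unfold

variable {A : Type} [MeasurableSpace A] {nA : ℕ} (coord : A → Fin nA → ℂ) (hcoord : ∀ a, Measurable fun x => coord x a)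
  (bonds : R.carriers.Dom → Finset (PBond (R.F.P R.K) 0)) (consts : B13.Consts) (pos : PosUnits consts)

/-- [folklore] The arguments of the frame of record at every domain are the fine-torus configurations with values in `A`. -/
theorem frameOfRecord_Arg (Y : R.carriers.Dom) : (frameOfRecord R A nA coord hcoord bonds consts pos).Arg Y = (PBond (R.F.P R.K) 0 → A) := rfl

/-- [folklore] The bond index of the frame of record at `Y`. -/
theorem frameOfRecord_Bond (Y : R.carriers.Dom) : (frameOfRecord R A nA coord hcoord bonds consts pos).Bond Y = (↥(bonds Y) × Fin nA) := rfl

/-- [folklore] The bond variables of the frame of record are the coordinates of the bond letters. -/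
theorem frameOfRecord_Bv (Y : R.carriers.Dom) (φ : PBond (R.F.P R.K) 0 → A) (b : ↥(bonds Y) × Fin nA) :
    (frameOfRecord R A nA coord hcoord bonds consts pos).Bv Y φ b = coord (φ b.1.1) b.2 := rfl

/-- [folklore] The volume of the frame of record is the cube count. -/
theorem frameOfRecord_vol (Y : R.carriers.Dom) : (frameOfRecord R A nA coord hcoord bonds consts pos).vol Y = Y.2.1.card := rfl

/-- [folklore] The constants of the frame of record are the supplied letters. -/
theorem frameOfRecord_consts : (frameOfRecord R A nA coord hcoord bonds consts pos).consts = consts := rfl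

end Unfold

/-- [folklore] **THE FRAME OF RECORD WITH THE BOND SETS OF RECORD**: the bonds of a domain are the fine bonds of run A sourced in its cubes
(`B13CarriersFootprint.bondsAt X 0`, p208379).  LEVEL-0 variant; not of record for domains of scale ≥ 1 (of record: `frameAtScale`, §2). -/
def frameOfRecordStd (A : Type) [MeasurableSpace A] (nA : ℕ) (coord : A → Fin nA → ℂ) (hcoord : ∀ a, Measurable fun x => coord x a)
    (consts : B13.Consts) (pos : PosUnits consts) : MeasPotFrame R.carriers :=
  frameOfRecord R A nA coord hcoord (fun X => bondsAt X 0) consts pos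

/-- [folklore] The standard frame's bond index at `X`: the fine bonds in `X` times the coordinate index. -/
theorem frameOfRecordStd_Bond {A : Type} [MeasurableSpace A] {nA : ℕ} (coord : A → Fin nA → ℂ) (hcoord : ∀ a, Measurable fun x => coord x a)
    (consts : B13.Consts) (pos : PosUnits consts) (X : R.carriers.Dom) :
    (frameOfRecordStd R A nA coord hcoord consts pos).Bond X = (↥(bondsAt X 0) × Fin nA) := rfl

/-- [folklore] On the driven runs (`DrivenRuns`, p217182) the frame of record is that of the underlying `TwoRuns`. -/
def frameOfDriven {G : Type} [GaugeGroup G] (D : DrivenRuns G) (A : Type) [MeasurableSpace A] (nA : ℕ) (coord : A → Fin nA → ℂ)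
    (hcoord : ∀ a, Measurable fun x => coord x a) (consts : B13.Consts) (pos : PosUnits consts) : MeasPotFrame D.carriers :=
  frameOfRecordStd D.toTwoRuns A nA coord hcoord consts pos

/-! ## §2 (v1.1) The level-polymorphic frame and the PRINT placement `frameAtScale` — the frame OF RECORD (NE5-p1 R45) -/

/-- [folklore] DATA **`frameOfRecordLvl`** (typer sketch v0.5 §FRL verbatim): `frameOfRecord` with the potentials' ARGUMENT and BOND INDEX on a
per-domain level `lvl X` — `Arg X := PBond (R.F.P R.K) (lvl X) → A`, `Bond X := ↥(bonds X) × Fin nA`, `Bv X φ (b, a) := coord (φ b) a`,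
`vol X := |X|` in cubes; `frameOfRecord` is the case `lvl ≡ 0`. -/
def frameOfRecordLvl (A : Type) [MeasurableSpace A] (nA : ℕ) (coord : A → Fin nA → ℂ) (hcoord : ∀ a, Measurable fun x => coord x a)
    (lvl : R.carriers.Dom → ℕ) (bonds : (X : R.carriers.Dom) → Finset (PBond (R.F.P R.K) (lvl X))) (consts : B13.Consts)
    (pos : PosUnits consts) : MeasPotFrame R.carriers where
  Arg := fun X => PBond (R.F.P R.K) (lvl X) → A
  Bond := fun X => ↥(bonds X) × Fin nA
  finBond := fun _ => inferInstance
  Bv := fun _ φ b => coord (φ b.1.1) b.2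
  vol := fun Y => Y.2.1.card
  consts := consts
  pos := pos
  meas := fun _ => inferInstance
  measurable_Bv := fun _ b => (hcoord b.2).comp (measurable_pi_apply _)

section UnfoldLvl

variable {A : Type} [MeasurableSpace A] {nA : ℕ} (coord : A → Fin nA → ℂ) (hcoord : ∀ a, Measurable fun x => coord x a)
  (lvl : R.carriers.Dom → ℕ) (bonds : (X : R.carriers.Dom) → Finset (PBond (R.F.P R.K) (lvl X))) (consts : B13.Consts) (pos : PosUnits consts)

/-- [folklore] The arguments of the level-polymorphic frame at `X`: run A's level-`lvl X` configurations with values in `A`. -/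
theorem frameOfRecordLvl_Arg (X : R.carriers.Dom) :
    (frameOfRecordLvl R A nA coord hcoord lvl bonds consts pos).Arg X = (PBond (R.F.P R.K) (lvl X) → A) := rfl

/-- [folklore] The bond index of the level-polymorphic frame at `X`. -/
theorem frameOfRecordLvl_Bond (X : R.carriers.Dom) :
    (frameOfRecordLvl R A nA coord hcoord lvl bonds consts pos).Bond X = (↥(bonds X) × Fin nA) := rfl

/-- [folklore] The bond variables of the level-polymorphic frame are the coordinates of the bond letters. -/
theorem frameOfRecordLvl_Bv (X : R.carriers.Dom) (φ : PBond (R.F.P R.K) (lvl X) → A) (b : ↥(bonds X) × Fin nA) :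
    (frameOfRecordLvl R A nA coord hcoord lvl bonds consts pos).Bv X φ b = coord (φ b.1.1) b.2 := rfl

/-- [folklore] The volume of the level-polymorphic frame is the cube count. -/
theorem frameOfRecordLvl_vol (X : R.carriers.Dom) : (frameOfRecordLvl R A nA coord hcoord lvl bonds consts pos).vol X = X.2.1.card := rfl

/-- [folklore] The level-`0` instance of the level-polymorphic frame IS `frameOfRecord`. -/
theorem frameOfRecordLvl_zero (bonds₀ : R.carriers.Dom → Finset (PBond (R.F.P R.K) 0)) :
    frameOfRecordLvl R A nA coord hcoord (fun _ => 0) bonds₀ consts pos = frameOfRecord R A nA coord hcoord bonds₀ consts pos := rfl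

end UnfoldLvl

/-- [folklore] DATA **`frameAtScale` — THE FRAME OF RECORD** (PRINT placement, [Balaban1987RG1] p. 269 §3 ¶1 and [Balaban1988RG2Cluster]
(1.40)–(1.43) pp. 10–11, KIND only; NE5-p1 ruling R45): the fluctuation field of a domain `X ∈ 𝐃_k` lives on run A's level `k = X.1`
(`T₁^{(k)}`); bonds of record `bondsAt X X.1` (the level-`X.1` bonds sourced in the cubes of `X`, `B13CarriersFootprint`). -/
def frameAtScale (A : Type) [MeasurableSpace A] (nA : ℕ) (coord : A → Fin nA → ℂ) (hcoord : ∀ a, Measurable fun x => coord x a)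
    (consts : B13.Consts) (pos : PosUnits consts) : MeasPotFrame R.carriers :=
  frameOfRecordLvl R A nA coord hcoord (fun X => X.1) (fun X => bondsAt X X.1) consts pos

section UnfoldScale

variable {A : Type} [MeasurableSpace A] {nA : ℕ} (coord : A → Fin nA → ℂ) (hcoord : ∀ a, Measurable fun x => coord x a)
  (consts : B13.Consts) (pos : PosUnits consts)

/-- [folklore] The scale frame's arguments at `X`: run A's level-`X.1` configurations. -/
theorem frameAtScale_Arg (X : R.carriers.Dom) : (frameAtScale R A nA coord hcoord consts pos).Arg X = (PBond (R.F.P R.K) X.1 → A) := rfl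

/-- [folklore] The scale frame's bond index at `X` (rfl view): the level-`X.1` bonds in `X` times the coordinate index. -/
theorem frameAtScale_Bond (X : R.carriers.Dom) : (frameAtScale R A nA coord hcoord consts pos).Bond X = (↥(bondsAt X X.1) × Fin nA) := rfl

/-- [folklore] The scale frame's bond variables are the coordinates of the bond letters. -/
theorem frameAtScale_Bv (X : R.carriers.Dom) (φ : PBond (R.F.P R.K) X.1 → A) (b : ↥(bondsAt X X.1) × Fin nA) :
    (frameAtScale R A nA coord hcoord consts pos).Bv X φ b = coord (φ b.1.1) b.2 := rfl

/-- [folklore] The scale frame's volume is the cube count and its constants are the supplied letters. -/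
theorem frameAtScale_vol (X : R.carriers.Dom) : (frameAtScale R A nA coord hcoord consts pos).vol X = X.2.1.card := rfl

/-- [folklore] The scale frame's constants are the supplied letters. -/
theorem frameAtScale_consts : (frameAtScale R A nA coord hcoord consts pos).consts = consts := rfl

/-- [folklore] **[II] (1.43)'s BOND COUNT PER DOMAIN**: `|Bond X| = |bondsAt X X.1| · nA` (print: `dim 𝔤 · 4M⁴ · (M⁻⁴|Y|)` once the cubes of
`X` are read at their own level — the count of `bondsAt X X.1` is the footprint's, not claimed here). -/
theorem card_Bond_frameAtScale (X : R.carriers.Dom) :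
    Fintype.card ((frameAtScale R A nA coord hcoord consts pos).Bond X) = (bondsAt X X.1).card * nA := by
  have h : Fintype.card (↥(bondsAt X X.1) × Fin nA) = (bondsAt X X.1).card * nA := by
    rw [Fintype.card_prod, Fintype.card_coe, Fintype.card_fin]
  convert h using 2
  exact frameAtScale_Bond R coord hcoord consts pos X

end UnfoldScale

/-- [folklore] On the driven runs (`DrivenRuns`, p217182) the frame OF RECORD is the scale frame of the underlying `TwoRuns`. -/
def frameOfDrivenScale {G : Type} [GaugeGroup G] (D : DrivenRuns G) (A : Type) [MeasurableSpace A] (nA : ℕ) (coord : A → Fin nA → ℂ)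
    (hcoord : ∀ a, Measurable fun x => coord x a) (consts : B13.Consts) (pos : PosUnits consts) : MeasPotFrame D.carriers :=
  frameAtScale D.toTwoRuns A nA coord hcoord consts pos

/-- [folklore] The driven scale frame's bond index at `X` (rfl view). -/
theorem frameOfDrivenScale_Bond {G : Type} [GaugeGroup G] (D : DrivenRuns G) {A : Type} [MeasurableSpace A] {nA : ℕ}
    (coord : A → Fin nA → ℂ) (hcoord : ∀ a, Measurable fun x => coord x a) (consts : B13.Consts) (pos : PosUnits consts)
    (X : D.carriers.Dom) : (frameOfDrivenScale D A nA coord hcoord consts pos).Bond X = (↥(bondsAt X X.1) × Fin nA) := rfl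

end Summit.QuantumFields.BalabanUV.T4Continuum.SubstrateFrameOfRecord

end
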